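import Summits.HodgeConjecture.CorCM.Census.OcticDecicWeilPartsBalanced
import HarnessLib

/-!
# `E × B₄ × B₅` over an octic and a decic CM field sharing `k`: EXTRACTION of a part from every non-empty balanced configuration, and
# the INDUCTION PRINCIPLE for balanced configurations (any number of copies)

COR-CM (cell `pub-hodgecm2`), seat b30 gen 27 (2026-08-23); count-neutral own lane OCTIC-DECIC, sequel of
`Census/OcticDecicWeil{,Defect,Parts,PartsBalanced}.lean`; the degree-`(8,10)` twin of `Census/SexticDecicWeilExtraction.lean`.
Theorems of the finite model only; no definition, no named fact, no geometry, no `sorry`, no `decide`.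

EXTRACTION (greedy, from the defect law `d₂ ≡ t₂`, `d₃ ≡ t₃`, `e = 2t₂ + t₃` under a realised set `R` that is rotation-stable on the
decic pairs (`hrot`) and transitive on the octic pairs (`ht`)):
* `t₂ > 0 > t₃`: if `e > 0` a TEN part (`τ B₄⁺ B₅⁻`), else `−t₃ ≥ 2t₂ ≥ 2` and a FOURTEEN part (`B₄⁺ B₅⁻ B₅⁻`); symmetrically for
  `t₂ < 0 < t₃`;
* otherwise all non-zero defects share a sign: `t₂ ≠ 0` gives a SIX-FOUR part (`|e| ≥ 2|t₂| ≥ 2`), else `t₃ ≠ 0` a SIX-FIVE part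
  (`|e| = |t₃| ≥ 1`), else every count is conjugation-invariant and a non-empty configuration has a PAIR part.
Hence **`modelBalancedOD_induction`**.
[cite: Milne2020HodgeClassesAV, 1.2 (a) and Thm. 1] [cite: MoonenZarhin1995Duke, Thm. 2.4] [cite: GaoUllmo2025, Thm 3.1]

## References
* [Milne2020HodgeClassesAV] J. S. Milne, arXiv:2010.08857, 1.2 (a), Thm. 1.  [MoonenZarhin1995Duke] B. Moonen, Yu. Zarhin, Duke
  Math. J. 77 (1995), Thm. 2.4.  [GaoUllmo2025] Z. Gao, E. Ullmo, J. Inst. Math. Jussieu 25 (2025), Thm 3.1.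
-/

namespace Summit.HodgeConjecture.CorCM.Census.OcticDecicWeil

open Finset

variable {α : Type*} {R : Finset (Equiv.Perm (Fin 4) × Equiv.Perm (Fin 5))} {v : α → PtOD}

/-! ### Membership and non-emptiness of the composite parts -/

/-- Every point of a six-four part lies over `inl b` or over a label `(1, a, b)`. [folklore] -/
theorem IsSixFourPartOD.mem_cases [DecidableEq α] {b : Bool} {G : Finset α} (hG : IsSixFourPartOD v b G) {x : α} (hx : x ∈ G) :
    v x = Sum.inl b ∨ ∃ a : Fin 4, v x = Sum.inr (Sum.inl (a, b)) := by
  obtain ⟨C, G₁, -, rfl, -, hvC, hG₁⟩ := hG.exists_split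
  rcases Finset.mem_union.1 hx with hx | hx
  · exact Or.inl (hvC x hx)
  · exact Or.inr (hG₁.exists_eq hx)

/-- Every point of a six-five part lies over `inl b` or over a label `(2, a, b)`. [folklore] -/
theorem IsSixFivePartOD.mem_cases [DecidableEq α] {b : Bool} {G : Finset α} (hG : IsSixFivePartOD v b G) {x : α} (hx : x ∈ G) :
    v x = Sum.inl b ∨ ∃ a : Fin 5, v x = Sum.inr (Sum.inr (a, b)) := by
  obtain ⟨x₀, G₁, -, rfl, hvx₀, hG₁⟩ := hG.exists_split
  rcases Finset.mem_insert.1 hx with rfl | hx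
  · exact Or.inl hvx₀
  · exact Or.inr (hG₁.exists_eq hx)

/-- Every point of a ten part lies over `inl b`, over a label `(1, a, b)` or over a label `(2, a, ¬b)`. [folklore] -/
theorem IsTenPartOD.mem_cases [DecidableEq α] {b : Bool} {G : Finset α} (hG : IsTenPartOD v b G) {x : α} (hx : x ∈ G) :
    v x = Sum.inl b ∨ (∃ a : Fin 4, v x = Sum.inr (Sum.inl (a, b))) ∨ ∃ a : Fin 5, v x = Sum.inr (Sum.inr (a, !b)) := by
  obtain ⟨x₀, G₁, G₂, -, -, -, rfl, hvx₀, hG₁, hG₂⟩ := hG.exists_split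
  rcases Finset.mem_insert.1 hx with rfl | hx
  · exact Or.inl hvx₀
  · rcases Finset.mem_union.1 hx with hx | hx
    · exact Or.inr (Or.inl (hG₁.exists_eq hx))
    · exact Or.inr (Or.inr (hG₂.exists_eq hx))

/-- Every point of a fourteen part lies over a label `(1, a, b)` or over a label `(2, a, ¬b)`. [folklore] -/
theorem IsFourteenPartOD.mem_cases [DecidableEq α] {b : Bool} {G : Finset α} (hG : IsFourteenPartOD v b G) {x : α} (hx : x ∈ G) :
    (∃ a : Fin 4, v x = Sum.inr (Sum.inl (a, b))) ∨ ∃ a : Fin 5, v x = Sum.inr (Sum.inr (a, !b)) := by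
  obtain ⟨G₀, G₁, G₂, -, -, -, rfl, hG₀, hG₁, hG₂⟩ := hG.exists_split
  rcases Finset.mem_union.1 hx with hx | hx
  · rcases Finset.mem_union.1 hx with hx | hx
    · exact Or.inl (hG₀.exists_eq hx)
    · exact Or.inr (hG₁.exists_eq hx)
  · exact Or.inr (hG₂.exists_eq hx)

/-- A six-four part is non-empty. [folklore] -/
theorem IsSixFourPartOD.nonempty {b : Bool} {G : Finset α} (hG : IsSixFourPartOD v b G) : G.Nonempty := by
  rw [← Finset.card_pos, hG.1]; norm_num

/-- A six-five part is non-empty. [folklore] -/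
theorem IsSixFivePartOD.nonempty {b : Bool} {G : Finset α} (hG : IsSixFivePartOD v b G) : G.Nonempty := by
  rw [← Finset.card_pos, hG.1]; norm_num

/-- A ten part is non-empty. [folklore] -/
theorem IsTenPartOD.nonempty {b : Bool} {G : Finset α} (hG : IsTenPartOD v b G) : G.Nonempty := by
  rw [← Finset.card_pos, hG.1]; norm_num

/-- A fourteen part is non-empty. [folklore] -/
theorem IsFourteenPartOD.nonempty {b : Bool} {G : Finset α} (hG : IsFourteenPartOD v b G) : G.Nonempty := by
  rw [← Finset.card_pos, hG.1]; norm_num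

/-! ### The composite parts from the counts -/

/-- Filters of a union with a quad part over labels off the quad part. [folklore] -/
private theorem card_filter_union_quad [DecidableEq α] {b : Bool} {W S : Finset α} (hW : IsQuadPartOD v b W) {z : PtOD}
    (hz : ∀ a : Fin 4, z ≠ Sum.inr (Sum.inl (a, b))) :
    ((S ∪ W).filter fun x => v x = z).card = (S.filter fun x => v x = z).card := by
  rw [Finset.filter_union, Finset.filter_false_of_mem (s := W) fun x hx h => ?_, Finset.union_empty]
  obtain ⟨a, ha⟩ := hW.exists_eq hx
  exact hz a (h.symm.trans ha)

/-- Filters of a union with a five part over labels off the five part. [folklore] -/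
private theorem card_filter_union_five [DecidableEq α] {b : Bool} {W S : Finset α} (hW : IsFivePartOD v b W) {z : PtOD}
    (hz : ∀ a : Fin 5, z ≠ Sum.inr (Sum.inr (a, b))) :
    ((S ∪ W).filter fun x => v x = z).card = (S.filter fun x => v x = z).card := by
  rw [Finset.filter_union, Finset.filter_false_of_mem (s := W) fun x hx h => ?_, Finset.union_empty]
  obtain ⟨a, ha⟩ := hW.exists_eq hx
  exact hz a (h.symm.trans ha)

/-- `n` points of `T` over the label `y`, given `n ≤ N(y)`. [folklore] -/
private theorem exists_fibre_subset [DecidableEq α] {T : Finset α} (y : PtOD) {n : ℕ} (hn : n ≤ (T.filter fun x => v x = y).card) :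
    ∃ C ⊆ T, C.card = n ∧ ∀ x ∈ C, v x = y := by
  obtain ⟨C, hC, hcard⟩ := Finset.exists_subset_card_eq hn
  exact ⟨C, fun x hx => (Finset.mem_filter.1 (hC hx)).1, hcard, fun x hx => (Finset.mem_filter.1 (hC hx)).2⟩

/-- A six-four part inside `T` from the counts (two curve points over `τ_b`). [folklore] -/
theorem exists_sixFourPartOD_of_counts [DecidableEq α] {T : Finset α} (b : Bool) (hE : 2 ≤ (T.filter fun x => v x = Sum.inl b).card)
    (hB : ∀ a : Fin 4, 0 < (T.filter fun x => v x = Sum.inr (Sum.inl (a, b))).card) : ∃ G ⊆ T, IsSixFourPartOD v b G := by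
  obtain ⟨C, hCT, hC, hvC⟩ := exists_fibre_subset (v := v) (Sum.inl b) hE
  obtain ⟨W, hWT, hW⟩ := exists_quadPartOD_of_counts (v := v) (T := T) b hB
  have hCW : Disjoint C W := by
    rw [Finset.disjoint_left]
    intro x hxC hxW
    obtain ⟨a, ha⟩ := hW.exists_eq hxW
    rw [hvC x hxC] at ha; exact Sum.inl_ne_inr ha
  refine ⟨C ∪ W, Finset.union_subset hCT hWT, ?_, ?_, fun a => ?_⟩
  · rw [Finset.card_union_of_disjoint hCW, hC, hW.1]
  · rw [card_filter_union_quad (S := C) hW fun a => Sum.inl_ne_inr, Finset.filter_true_of_mem hvC, hC]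
  · rw [Finset.filter_union, Finset.filter_false_of_mem (s := C) fun x hx h => ?_, Finset.empty_union, hW.2 a]
    rw [hvC x hx] at h; exact Sum.inl_ne_inr h

/-- A six-five part inside `T` from the counts. [folklore] -/
theorem exists_sixFivePartOD_of_counts [DecidableEq α] {T : Finset α} (b : Bool) (hE : 0 < (T.filter fun x => v x = Sum.inl b).card)
    (hB : ∀ a : Fin 5, 0 < (T.filter fun x => v x = Sum.inr (Sum.inr (a, b))).card) : ∃ G ⊆ T, IsSixFivePartOD v b G := by
  obtain ⟨C, hCT, hC, hvC⟩ := exists_fibre_subset (v := v) (Sum.inl b) (Nat.one_le_of_lt hE)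
  obtain ⟨W, hWT, hW⟩ := exists_fivePartOD_of_counts (v := v) (T := T) b hB
  have hCW : Disjoint C W := by
    rw [Finset.disjoint_left]
    intro x hxC hxW
    obtain ⟨a, ha⟩ := hW.exists_eq hxW
    rw [hvC x hxC] at ha; exact Sum.inl_ne_inr ha
  refine ⟨C ∪ W, Finset.union_subset hCT hWT, ?_, ?_, fun a => ?_⟩
  · rw [Finset.card_union_of_disjoint hCW, hC, hW.1]
  · rw [card_filter_union_five (S := C) hW fun a => Sum.inl_ne_inr, Finset.filter_true_of_mem hvC, hC]
  · rw [Finset.filter_union, Finset.filter_false_of_mem (s := C) fun x hx h => ?_, Finset.empty_union, hW.2 a]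
    rw [hvC x hx] at h; exact Sum.inl_ne_inr h

/-- A ten part inside `T` from the counts. [folklore] -/
theorem exists_tenPartOD_of_counts [DecidableEq α] {T : Finset α} (b : Bool)
    (hE : 0 < (T.filter fun x => v x = Sum.inl b).card)
    (hB₄ : ∀ a : Fin 4, 0 < (T.filter fun x => v x = Sum.inr (Sum.inl (a, b))).card)
    (hB₅ : ∀ a : Fin 5, 0 < (T.filter fun x => v x = Sum.inr (Sum.inr (a, !b))).card) : ∃ G ⊆ T, IsTenPartOD v b G := by
  obtain ⟨C, hCT, hC, hvC⟩ := exists_fibre_subset (v := v) (Sum.inl b) (Nat.one_le_of_lt hE)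
  obtain ⟨W₁, hW₁T, hW₁⟩ := exists_quadPartOD_of_counts (v := v) (T := T) b hB₄
  obtain ⟨W₂, hW₂T, hW₂⟩ := exists_fivePartOD_of_counts (v := v) (T := T) (!b) hB₅
  have hCW₁ : Disjoint C W₁ := by
    rw [Finset.disjoint_left]
    intro x hxC hxW
    obtain ⟨a, ha⟩ := hW₁.exists_eq hxW
    rw [hvC x hxC] at ha; exact Sum.inl_ne_inr ha
  have hW₁₂ : Disjoint W₁ W₂ := by
    rw [Finset.disjoint_left]
    intro x hx1 hx2
    obtain ⟨a, ha⟩ := hW₁.exists_eq hx1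
    obtain ⟨a', ha'⟩ := hW₂.exists_eq hx2
    have := ha.symm.trans ha'
    simp at this
  have hCW₂ : Disjoint (C ∪ W₁) W₂ := by
    rw [Finset.disjoint_union_left]
    refine ⟨Finset.disjoint_left.2 fun x hxC hxW => ?_, hW₁₂⟩
    obtain ⟨a, ha⟩ := hW₂.exists_eq hxW
    rw [hvC x hxC] at ha; exact Sum.inl_ne_inr ha
  refine ⟨C ∪ W₁ ∪ W₂, Finset.union_subset (Finset.union_subset hCT hW₁T) hW₂T, ?_, ?_, fun a => ?_, fun a => ?_⟩
  · rw [Finset.card_union_of_disjoint hCW₂, Finset.card_union_of_disjoint hCW₁, hC, hW₁.1, hW₂.1]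
  · rw [card_filter_union_five (S := C ∪ W₁) hW₂ fun a => Sum.inl_ne_inr,
      card_filter_union_quad (S := C) hW₁ fun a => Sum.inl_ne_inr, Finset.filter_true_of_mem hvC, hC]
  · have hq := card_filter_union_five (S := C ∪ W₁) hW₂ (z := Sum.inr (Sum.inl (a, b))) fun a' h => by simp at h
    rw [hq, Finset.filter_union, Finset.filter_false_of_mem (s := C) fun x hx h => ?_, Finset.empty_union, hW₁.2 a]
    rw [hvC x hx] at h; exact Sum.inl_ne_inr h
  · rw [Finset.filter_union, Finset.filter_false_of_mem (s := C ∪ W₁) fun x hx h => ?_, Finset.empty_union, hW₂.2 a]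
    rcases Finset.mem_union.1 hx with hx | hx
    · rw [hvC x hx] at h; exact Sum.inl_ne_inr h
    · obtain ⟨a', ha'⟩ := hW₁.exists_eq hx
      have := h.symm.trans ha'
      simp at this

/-- A fourteen part inside `T` from the counts (two points over each `(2, a, ¬b)`). [folklore] -/
theorem exists_fourteenPartOD_of_counts [DecidableEq α] {T : Finset α} (b : Bool)
    (hB₄ : ∀ a : Fin 4, 0 < (T.filter fun x => v x = Sum.inr (Sum.inl (a, b))).card)
    (hB₅ : ∀ a : Fin 5, 2 ≤ (T.filter fun x => v x = Sum.inr (Sum.inr (a, !b))).card) : ∃ G ⊆ T, IsFourteenPartOD v b G := by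
  obtain ⟨W₀, hW₀T, hW₀⟩ := exists_quadPartOD_of_counts (v := v) (T := T) b hB₄
  obtain ⟨W₁, hW₁T, hW₁⟩ := exists_fivePartOD_of_counts (v := v) (T := T) (!b) fun a => by have h := hB₅ a; omega
  have hrest : ∀ a : Fin 5, 0 < ((T \ W₁).filter fun x => v x = Sum.inr (Sum.inr (a, !b))).card := by
    intro a
    have h1 : ((T \ W₁).filter fun x => v x = Sum.inr (Sum.inr (a, !b))).card =
        (T.filter fun x => v x = Sum.inr (Sum.inr (a, !b))).card - (W₁.filter fun x => v x = Sum.inr (Sum.inr (a, !b))).card := by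
      rw [← Finset.card_sdiff_of_subset (Finset.filter_subset_filter _ hW₁T)]
      congr 1
      ext x
      simp only [Finset.mem_filter, Finset.mem_sdiff]
      tauto
    rw [h1, hW₁.2 a]
    have h := hB₅ a; omega
  obtain ⟨W₂, hW₂T', hW₂⟩ := exists_fivePartOD_of_counts (v := v) (T := T \ W₁) (!b) hrest
  have hW₂T : W₂ ⊆ T := fun z hz => (Finset.mem_sdiff.1 (hW₂T' hz)).1
  have h12 : Disjoint W₁ W₂ := Finset.disjoint_left.2 fun z hz1 hz2 => (Finset.mem_sdiff.1 (hW₂T' hz2)).2 hz1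
  have hq5 : ∀ {W : Finset α}, IsFivePartOD v (!b) W → Disjoint W₀ W := fun hW => by
    rw [Finset.disjoint_left]
    intro x hx0 hx1
    obtain ⟨a, ha⟩ := hW₀.exists_eq hx0
    obtain ⟨a', ha'⟩ := hW.exists_eq hx1
    have := ha.symm.trans ha'
    simp at this
  have h012 : Disjoint (W₀ ∪ W₁) W₂ := Finset.disjoint_union_left.2 ⟨hq5 hW₂, h12⟩
  refine ⟨W₀ ∪ W₁ ∪ W₂, Finset.union_subset (Finset.union_subset hW₀T hW₁T) hW₂T, ?_, fun a => ?_, fun a => ?_⟩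
  · rw [Finset.card_union_of_disjoint h012, Finset.card_union_of_disjoint (hq5 hW₁), hW₀.1, hW₁.1, hW₂.1]
  · have hq := card_filter_union_five (S := W₀ ∪ W₁) hW₂ (z := Sum.inr (Sum.inl (a, b))) fun a' h => by simp at h
    have hq' := card_filter_union_five (S := W₀) hW₁ (z := Sum.inr (Sum.inl (a, b))) fun a' h => by simp at h
    rw [hq, hq', hW₀.2 a]
  · rw [Finset.filter_union, Finset.card_union_of_disjoint (Finset.disjoint_filter_filter h012), Finset.filter_union,
      Finset.filter_false_of_mem (s := W₀) fun x hx h => ?_, Finset.empty_union, hW₁.2 a, hW₂.2 a]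
    obtain ⟨a', ha'⟩ := hW₀.exists_eq hx
    have := h.symm.trans ha'
    simp at this

/-! ### Extraction and induction -/

section Extraction

variable (g : Equiv.Perm (Fin 5)) (hrot : ∀ π ∈ R, (π.1, π.2 * (g * finRotate 5 * g⁻¹)) ∈ R) (ht : ∀ x : Fin 4, ∃ π ∈ R, π.1 x = 0)

include g hrot ht in
/-- **EXTRACTION.**  Under a rotation-stable, octic-transitive `R`, a non-empty `R`-balanced configuration contains a pair, six-four,
six-five, ten or fourteen part (module docstring: greedy on the signs of the defects `t₂`, `t₃`, `e = 2t₂ + t₃`).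
[cite: Milne2020HodgeClassesAV, 1.2 (a) and Thm. 1] [cite: MoonenZarhin1995Duke, Thm. 2.4] -/
theorem exists_part_of_modelBalancedOD [DecidableEq α] {T : Finset α} (hT : ModelBalancedOD R v T) (hne : T.Nonempty) :
    ∃ G ⊆ T, IsPairPartOD v G ∨ (∃ b, IsSixFourPartOD v b G) ∨ (∃ b, IsSixFivePartOD v b G) ∨ (∃ b, IsTenPartOD v b G) ∨
      ∃ b, IsFourteenPartOD v b G := by
  obtain ⟨t₂, t₃, h₂, h₃, hE⟩ := exists_defectOD_of_modelBalancedOD g hrot ht hT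
  -- opposite strict signs, `t₂ > 0 > t₃`
  by_cases hA : 0 < t₂ ∧ t₃ < 0
  · obtain ⟨ht₂, ht₃⟩ := hA
    by_cases he : 0 < 2 * t₂ + t₃
    · obtain ⟨G, hG, h⟩ := exists_tenPartOD_of_counts (v := v) (T := T) true (by omega)
        (fun a => by have h := h₂ a; omega) (fun a => by have h := h₃ a; rw [Bool.not_true]; omega)
      exact ⟨G, hG, Or.inr (Or.inr (Or.inr (Or.inl ⟨true, h⟩)))⟩
    · obtain ⟨G, hG, h⟩ := exists_fourteenPartOD_of_counts (v := v) (T := T) true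
        (fun a => by have h := h₂ a; omega) (fun a => by have h := h₃ a; rw [Bool.not_true]; omega)
      exact ⟨G, hG, Or.inr (Or.inr (Or.inr (Or.inr ⟨true, h⟩)))⟩
  -- opposite strict signs, `t₂ < 0 < t₃`
  by_cases hB : t₂ < 0 ∧ 0 < t₃
  · obtain ⟨ht₂, ht₃⟩ := hB
    by_cases he : 2 * t₂ + t₃ < 0
    · obtain ⟨G, hG, h⟩ := exists_tenPartOD_of_counts (v := v) (T := T) false (by omega)
        (fun a => by have h := h₂ a; omega) (fun a => by have h := h₃ a; rw [Bool.not_false]; omega)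
      exact ⟨G, hG, Or.inr (Or.inr (Or.inr (Or.inl ⟨false, h⟩)))⟩
    · obtain ⟨G, hG, h⟩ := exists_fourteenPartOD_of_counts (v := v) (T := T) false
        (fun a => by have h := h₂ a; omega) (fun a => by have h := h₃ a; rw [Bool.not_false]; omega)
      exact ⟨G, hG, Or.inr (Or.inr (Or.inr (Or.inr ⟨false, h⟩)))⟩
  -- a six-four part
  by_cases h2p : 0 < t₂
  · have ht₃ : 0 ≤ t₃ := by by_contra h; exact hA ⟨h2p, by omega⟩
    obtain ⟨G, hG, h⟩ := exists_sixFourPartOD_of_counts (v := v) (T := T) true (by omega) fun a => by have h := h₂ a; omega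
    exact ⟨G, hG, Or.inr (Or.inl ⟨true, h⟩)⟩
  by_cases h2n : t₂ < 0
  · have ht₃ : t₃ ≤ 0 := by by_contra h; exact hB ⟨h2n, by omega⟩
    obtain ⟨G, hG, h⟩ := exists_sixFourPartOD_of_counts (v := v) (T := T) false (by omega) fun a => by have h := h₂ a; omega
    exact ⟨G, hG, Or.inr (Or.inl ⟨false, h⟩)⟩
  have ht₂ : t₂ = 0 := by omega
  -- a six-five part
  by_cases h3p : 0 < t₃
  · obtain ⟨G, hG, h⟩ := exists_sixFivePartOD_of_counts (v := v) (T := T) true (by omega) fun a => by have h := h₃ a; omega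
    exact ⟨G, hG, Or.inr (Or.inr (Or.inl ⟨true, h⟩))⟩
  by_cases h3n : t₃ < 0
  · obtain ⟨G, hG, h⟩ := exists_sixFivePartOD_of_counts (v := v) (T := T) false (by omega) fun a => by have h := h₃ a; omega
    exact ⟨G, hG, Or.inr (Or.inr (Or.inl ⟨false, h⟩))⟩
  have ht₃ : t₃ = 0 := by omega
  -- all defects vanish: conjugation-invariant counts, a pair part
  subst ht₂ ht₃
  obtain ⟨x, hx⟩ := hne
  have hNx : 0 < (T.filter fun x' => v x' = v x).card := Finset.card_pos.2 ⟨x, Finset.mem_filter.2 ⟨hx, rfl⟩⟩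
  have hNcx : 0 < (T.filter fun x' => v x' = cjOD (v x)).card := by
    rcases hvx : v x with s | ⟨⟨a, s⟩ | ⟨a, s⟩⟩ <;> rw [hvx] at hNx
    · cases s
      · rw [cjOD_inl, Bool.not_false]; omega
      · rw [cjOD_inl, Bool.not_true]; omega
    · have h := h₂ a
      cases s
      · rw [cjOD_inr_inl, Bool.not_false]; omega
      · rw [cjOD_inr_inl, Bool.not_true]; omega
    · have h := h₃ a
      cases s
      · rw [cjOD_inr_inr, Bool.not_false]; omega
      · rw [cjOD_inr_inr, Bool.not_true]; omega
  obtain ⟨G, hG, hP'⟩ := exists_pairPartOD_of_counts (y := v x) hNx hNcx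
  exact ⟨G, hG, Or.inl hP'⟩

include g hrot ht in
/-- **INDUCTION PRINCIPLE FOR BALANCED CONFIGURATIONS (any number of copies of `E, B₄, B₅`).**  If `motive` holds for `∅` and passes from
`S` to `G ∪ S` for `G` disjoint from `S` a pair, six-four, six-five, ten or fourteen part, then `motive` holds for every `R`-balanced
configuration (`R` rotation-stable on the decic pairs and transitive on the octic pairs). [cite: Milne2020HodgeClassesAV, 1.2 (a) and Thm. 1]
[cite: GaoUllmo2025, Thm 3.1] -/
theorem modelBalancedOD_induction [DecidableEq α] {motive : Finset α → Prop} (h0 : motive ∅)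
    (hpair : ∀ G S : Finset α, Disjoint G S → IsPairPartOD v G → motive S → motive (G ∪ S))
    (hsix₄ : ∀ (G S : Finset α) (b : Bool), Disjoint G S → IsSixFourPartOD v b G → motive S → motive (G ∪ S))
    (hsix₅ : ∀ (G S : Finset α) (b : Bool), Disjoint G S → IsSixFivePartOD v b G → motive S → motive (G ∪ S))
    (hten : ∀ (G S : Finset α) (b : Bool), Disjoint G S → IsTenPartOD v b G → motive S → motive (G ∪ S))
    (hfourteen : ∀ (G S : Finset α) (b : Bool), Disjoint G S → IsFourteenPartOD v b G → motive S → motive (G ∪ S))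
    {T : Finset α} (hT : ModelBalancedOD R v T) : motive T := by
  induction T using Finset.strongInduction with
  | H T ih =>
    by_cases hTe : T = ∅
    · subst hTe; exact h0
    obtain ⟨G, hGT, hG⟩ := exists_part_of_modelBalancedOD g hrot ht hT (Finset.nonempty_iff_ne_empty.2 hTe)
    have step : ModelBalancedOD R v G → G.Nonempty → (∀ S, Disjoint G S → motive S → motive (G ∪ S)) → motive T := by
      intro hGb hGne hstep
      have hR : ModelBalancedOD R v (T \ G) := hT.sdiff hGb hGT
      have hlt : T \ G ⊂ T := Finset.sdiff_ssubset hGT hGne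
      have h := hstep (T \ G) Finset.disjoint_sdiff (ih _ hlt hR)
      rwa [Finset.union_sdiff_of_subset hGT] at h
    rcases hG with hP | ⟨b, h6⟩ | ⟨b, h6'⟩ | ⟨b, h10⟩ | ⟨b, h14⟩
    · exact step (fun π _ => hP.balancedOD π) hP.nonempty fun S hd hm => hpair G S hd hP hm
    · exact step (fun π _ => h6.balancedOD π) h6.nonempty fun S hd hm => hsix₄ G S b hd h6 hm
    · exact step (fun π _ => h6'.balancedOD π) h6'.nonempty fun S hd hm => hsix₅ G S b hd h6' hm
    · exact step (fun π _ => h10.balancedOD π) h10.nonempty fun S hd hm => hten G S b hd h10 hm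
    · exact step (fun π _ => h14.balancedOD π) h14.nonempty fun S hd hm => hfourteen G S b hd h14 hm

end Extraction

end Summit.HodgeConjecture.CorCM.Census.OcticDecicWeil
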